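import Mathlib
import HarnessLib
import Summits.HubbardSuperconductivity.HubbardSuperconductivity.Theorems.KLProgrammeKLRegimeEngineTowerWtNumericsPackageZWN

/-!
# Route `KLProgramme` — crux K3 ENGINE (stmt-HubbardSuperconductivity-20437 `KLRegimeEngineV17F2`), stub (b) v2, THE WEIGHTED HALF «(b)-WT4», numerics side
# (cell gate-hubbard-kl, seat p4 g22): ONE BLOCK-0 GROUP OF THE WEIGHTED ASSEMBLY, DISCHARGED — the adapter from `levNumerics_packageZWN` to the binder
# shapes of k3c3-p2's final weighted assembly (W14 `kernelNormsWt4_all_klEng_final` and its ♯2/♯3 re-keys): the SLOTS chosen, the rows served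

A block-0 group of the final weighted assembly (the base group at the read-out coupling — W14 at `λ_j`, ♯2/♯3 ONCE at `λ_d` («(b)-WT4-BLOCK0-RATE» cure (b)) —
or the levels group `1 ≤ j < d` of W11b) asks, on the level-0 weighted datum `(A₁, P₁, T₁)` (`Ab₀ = A₁ε_x/Klam²/B²`, `Qb₀ = P₁/ε_x²`, two-leg size
`T₁(|U| + c)/ε_x`, four-leg size `A₁P₁²|U|/ε_x³`) and the group's weighted names `W₀ Z₀ σ₀ τ₀ ψ₀ Φ₀` (equational, constants `Cκ₀ CJ₀ Cα`): slots
`A′₀ Q′₀ ι₁₀ ι₂₀ ι₃₀` with `W₀Ab₀ ≤ A′₀`, `Z₀Qb₀ ≤ Q′₀`, `W₀Z₀³Ab₀Qb₀³ ≤ ι₃₀`, the two import rows `… ≤ ι₁₀·λ`, `… ≤ ι₂₀·λ`, the five smallness rows at `λ`,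
a majorant array `ν` with its kit guard `Φ₀·towerV D τ₀ ν < 1`, and the read-out `Atot` (sharp) either under a CE row (levels group, `Cinc₀ Dinc₀`) or dominated
by the main base amplitude (base group, `Cinc₁ Dinc₁`).  **`levNumW_group`** serves ALL of it from `levNumerics_packageZWN` with the CHOICES `A′₀ := W₀Ab₀`,
`Q′₀ := Z₀Qb₀ + 1`, `ι₃₀ := A′₀Q′₀³`, `ι₁₀ := (two-leg size)·W₀Z₀/λ₀`, `ι₂₀ := (four-leg size)·W₀Z₀²/λ₀` at a SLOT coupling `λ₀` and rows at any `λ` with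
`Bf·Klam·U ≤ λ₀ ≤ λ ≤ κ·λ₀`, `λ ≤ uf₀` (base group: `λ₀ = λ = λ_d`, `κ = 1`; levels group: `λ₀ = λ_1`, `λ = λ_j ≤ d·λ_1`, `κ = d`), the array
`ν m := [two-leg, four-leg, W₀Z₀^m·Ab₀λ^{m−1}Qb₀^m]`, under the (U, c)-DOOR **`U, c ≤ ug := 1/(4·W₀₀Z₀₀·T₁·κ·Bf + 1)`** (two-leg product `ι₁₀·λ ≤ (M/β)/Bf`)
and `U ≤ 1`; closed forms `ab₀ = A₁/(2Klam²)`, `qb₀ = 4P₁`, `i₂₀ = 8W₀₀Z₀₀²A₁P₁²/Klam` + those of `levNumerics_packageZWN`; outputs `0 < uf₀, aT₁, qT₁, ug`, `0 ≤ CEf₀`.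
Pure real arithmetic; nothing about the model is asserted; nothing asserts (b), WT4, any stub, K3 or superconductivity.
References: BGM 2006 §2.8 (2.83)–(2.84), (2.93)–(2.98), Lemma 2.5 (2.98) [cite: BenfattoGiulianiMastropietro2006].
-/

noncomputable section

namespace Summit.HubbardSuperconductivity.HubbardSuperconductivity.Theorems.EngineV8

set_option linter.dupNamespace false -- summit = problem name (single-conjunct summit), D-0017

open Real Literature.MathematicalPhysics.QuantumLattice
open Summit.HubbardSuperconductivity.HubbardSuperconductivity.Theorems.KLRegimeSplit

set_option maxHeartbeats 1600000 in -- one ~50-binder statement over `levNumerics_packageZWN`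
/-- **ONE BLOCK-0 GROUP OF THE WEIGHTED ASSEMBLY, DISCHARGED** (slots, import rows, smallness rows, majorant array + guard, CE row / domination; see the module
docstring). [cite: BenfattoGiulianiMastropietro2006, §2.8 (2.83)-(2.84), (2.93)-(2.98), Lemma 2.5 (2.98)] -/
theorem levNumW_group
    {Cinc₀ Dinc₀ Cinc₁ Dinc₁ Cκ₀ Cα CJ₀ A₁ P₁ T₁ Klam κ : ℝ}
    (hCinc₀ : 0 < Cinc₀) (hDinc₀ : 1 ≤ Dinc₀) (hCinc₁ : 1 ≤ Cinc₁) (hDinc₁ : 1 ≤ Dinc₁) (hCκ₀ : 0 < Cκ₀) (hCα : 0 < Cα) (hCJ₀ : 0 < CJ₀)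
    (hA₁ : 0 < A₁) (hP₁ : 0 < P₁) (hT₁ : 0 < T₁) (hKlam : 1 ≤ Klam) (hκ : 1 ≤ κ)
    -- the r-free closed forms (instantiate with `rfl`)
    {ab₀ qb₀ i₂₀ W₀₀ Z₀₀ s₀₀ t₀₀ p₀₀ φ₀₀ QL₀ QH₀ aP₀ sC₀ Θ₀ uf₀ aT₀ aT₁ qT₀ qT₁ CEf₀ ug : ℝ} {Bf : ℝ}
    (hab₀ : ab₀ = A₁ / (2 * Klam ^ 2)) (hqb₀ : qb₀ = 4 * P₁)
    (hW₀₀ : W₀₀ = 16) (hZ₀₀ : Z₀₀ = (81 * CJ₀) ^ 2 / 8) (hi₂₀ : i₂₀ = 8 * W₀₀ * Z₀₀ ^ 2 * A₁ * P₁ ^ 2 / Klam)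
    (hs₀₀ : s₀₀ = 2 * Cκ₀ * klE0 / (162 ^ 2 * CJ₀ ^ 2)) (ht₀₀ : t₀₀ = 4 * exp 4 * (2 * Cκ₀ * klE0) / (162 ^ 2 * CJ₀ ^ 2))
    (hp₀₀ : p₀₀ = 162 ^ 2 * CJ₀ ^ 2 / (2 * Cκ₀ * klE0)) (hφ₀₀ : φ₀₀ = exp 1 * Cα / (Cκ₀ * klE0))
    (hQL₀ : QL₀ = Z₀₀ * qb₀) (hQH₀ : QH₀ = Z₀₀ * qb₀ + 1) (haP₀ : aP₀ = W₀₀ * ab₀)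
    (hsC₀ : sC₀ = i₂₀ / (2 * QL₀) + aP₀ * QH₀ ^ 3 / (4 * QL₀ ^ 2) + aP₀ * QH₀ / 4)
    (hΘ₀ : Θ₀ = exp 1 ^ 2 * φ₀₀ * t₀₀ ^ 2 * i₂₀ + exp 1 ^ 3 * φ₀₀ * t₀₀ ^ 3 * (aP₀ * QH₀ ^ 3) + exp 1 ^ 3 * φ₀₀ * t₀₀ ^ 3 * aP₀ * QH₀ ^ 3)
    (huf₀ : uf₀ = min 1 (min (1 / (8 * s₀₀ * QH₀ + 1)) (min (1 / (2 * exp 1 * t₀₀ * QH₀ + 1)) (1 / (4 * Θ₀ + 1)))))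
    (haT₀ : aT₀ = Cinc₀ * (ab₀ + aP₀ + exp 1 * φ₀₀ * t₀₀ * (1 + sC₀) ^ 2 / QL₀))
    (haT₁ : aT₁ = Cinc₁ * (ab₀ + aP₀ + exp 1 * φ₀₀ * t₀₀ * (1 + sC₀) ^ 2 / QL₀))
    (hqT₀ : qT₀ = Dinc₀ * (1 + Dinc₀ * qb₀ + 4 * QH₀ + 2 * t₀₀ * p₀₀ * QH₀) / 4)
    (hqT₁ : qT₁ = Dinc₁ * (1 + Dinc₁ * qb₀ + 4 * QH₀ + 2 * t₀₀ * p₀₀ * QH₀))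
    (hCEf₀ : CEf₀ = qT₀ * Bf * max 1 (2 * aT₀)) (hug : ug = 1 / (4 * W₀₀ * Z₀₀ * T₁ * κ * Bf + 1))
    (hBf1 : 1 ≤ Bf) (hBf₀ : 4 * exp 1 * φ₀₀ * t₀₀ * (1 + sC₀) ≤ Bf) :
    0 < uf₀ ∧ 0 < aT₁ ∧ 0 < qT₁ ∧ 0 ≤ CEf₀ ∧ 0 < ug ∧
    ∀ (β : ℝ) (M : ℕ) [NeZero M], 0 < β → β ≤ M → ∀ (U c : ℝ), 0 < U → U ≤ 1 → 0 < c → U ≤ ug → c ≤ ug →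
    -- the level-0 weighted datum's amplitude names (equational)
    ∀ (Ab₀ Qb₀ : ℝ), Ab₀ = A₁ * imagTimeWeight β M / Klam ^ 2 / Bf ^ 2 → Qb₀ = P₁ / imagTimeWeight β M ^ 2 →
    -- the group's weighted pins and names (equational, W14's order)
    ∀ (αb₀ κb₀ crb₀ ccb₀ W₀ Z₀ σ₀ τ₀ ψ₀ Φ₀ : ℝ), αb₀ = Cα * ((M : ℝ) / β) → κb₀ = Real.sqrt (2 * Cκ₀ * klE0) → crb₀ = 81 * CJ₀ * M / β →
      ccb₀ = 162 * CJ₀ * M / β → W₀ = 32 * crb₀ / ccb₀ → Z₀ = imagTimeWeight β M ^ 2 * ccb₀ ^ 2 / 8 → σ₀ = κb₀ ^ 2 / ccb₀ ^ 2 →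
      τ₀ = 4 * exp 4 * κb₀ ^ 2 / ccb₀ ^ 2 → ψ₀ = ccb₀ ^ 2 / κb₀ ^ 2 → Φ₀ = exp 1 * αb₀ * ccb₀ / (κb₀ ^ 2 * crb₀) →
    -- the slot coupling `λ₀` and the row coupling `λ`
    ∀ (lam₀ lam : ℝ), Bf * Klam * U ≤ lam₀ → lam₀ ≤ lam → lam ≤ κ * lam₀ → lam ≤ uf₀ →
    -- the SLOTS (equational: the choices)
    ∀ (A'₀ Q'₀ ι₁₀ ι₂₀ ι₃₀ : ℝ), A'₀ = W₀ * Ab₀ → Q'₀ = Z₀ * Qb₀ + 1 →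
      ι₁₀ = W₀ * Z₀ ^ 1 * (T₁ * (|U| + c) / imagTimeWeight β M) / lam₀ → ι₂₀ = W₀ * Z₀ ^ 2 * (A₁ * P₁ ^ 2 * |U| / imagTimeWeight β M ^ 3) / lam₀ →
      ι₃₀ = A'₀ * Q'₀ ^ 3 →
    -- (a) signs and the three slot dominations
    (0 ≤ A'₀ ∧ 0 < Q'₀ ∧ W₀ * Ab₀ ≤ A'₀ ∧ Z₀ * Qb₀ ≤ Q'₀ ∧ W₀ * Z₀ ^ 3 * Ab₀ * Qb₀ ^ 3 ≤ ι₃₀) ∧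
    -- (b) the two import rows and the five smallness rows at `λ`
    (W₀ * Z₀ ^ 1 * (T₁ * (|U| + c) / imagTimeWeight β M) ≤ ι₁₀ * lam ∧ W₀ * Z₀ ^ 2 * (A₁ * P₁ ^ 2 * |U| / imagTimeWeight β M ^ 3) ≤ ι₂₀ * lam ∧
      4 * σ₀ * lam * Q'₀ < 1 ∧ 2 * lam * τ₀ * Q'₀ ≤ 1 ∧ exp 1 * τ₀ * lam * Q'₀ < 1 ∧
      Φ₀ * (τ₀ * (ι₁₀ * lam + ι₂₀ / (2 * Q'₀) + ι₃₀ / (4 * Q'₀ ^ 2) + A'₀ * Q'₀ / 4)) < 1 ∧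
      Φ₀ * (exp 1 * τ₀ * (ι₁₀ * lam) + (exp 1 * τ₀) ^ 2 * (ι₂₀ * lam) + (exp 1 * τ₀) ^ 3 * (ι₃₀ * lam ^ 2) +
        A'₀ * (exp 1 * τ₀ * Q'₀) * ((exp 1 * τ₀ * lam * Q'₀) ^ 3 / (1 - exp 1 * τ₀ * lam * Q'₀))) < 1) ∧
    -- (c) the majorant array (the choice) with its three majorant rows and its kit guard at every degree cap
    (∀ ν : ℕ → ℝ, ν = (fun m => if m = 1 then W₀ * Z₀ ^ 1 * (T₁ * (|U| + c) / imagTimeWeight β M)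
        else if m = 2 then W₀ * Z₀ ^ 2 * (A₁ * P₁ ^ 2 * |U| / imagTimeWeight β M ^ 3) else W₀ * Z₀ ^ m * (Ab₀ * lam ^ (m - 1) * Qb₀ ^ m)) →
      (∀ m, 3 ≤ m → W₀ * Z₀ ^ m * (Ab₀ * lam ^ (m - 1) * Qb₀ ^ m) ≤ ν m) ∧ W₀ * Z₀ ^ 1 * (T₁ * (|U| + c) / imagTimeWeight β M) ≤ ν 1 ∧
      W₀ * Z₀ ^ 2 * (A₁ * P₁ ^ 2 * |U| / imagTimeWeight β M ^ 3) ≤ ν 2 ∧ ∀ D : ℕ, Φ₀ * towerV D τ₀ ν < 1) ∧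
    -- (d) the CE row of the read-out with `Cinc₀ Dinc₀` (levels group)
    (∀ (Aro Qro Qtot Atot : ℝ), Aro = Cinc₀ * Ab₀ → Qro = Dinc₀ * Qb₀ → Qtot = Dinc₀ * max 1 (max Qro (max (4 * Q'₀) (2 * τ₀ * ψ₀ * Q'₀))) →
      Atot = Aro + Cinc₀ * (A'₀ * (4 * σ₀ * lam * Q'₀ / (1 - 4 * σ₀ * lam * Q'₀)) +
        exp 1 * (τ₀ * (ι₁₀ * lam + ι₂₀ / (2 * Q'₀) + ι₃₀ / (4 * Q'₀ ^ 2) + A'₀ * Q'₀ / 4)) *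
          (Φ₀ * (τ₀ * (ι₁₀ * lam + ι₂₀ / (2 * Q'₀) + ι₃₀ / (4 * Q'₀ ^ 2) + A'₀ * Q'₀ / 4)) /
            (1 - Φ₀ * (τ₀ * (ι₁₀ * lam + ι₂₀ / (2 * Q'₀) + ι₃₀ / (4 * Q'₀ ^ 2) + A'₀ * Q'₀ / 4)))) / (2 * τ₀ * Q'₀)) →
      Qtot * imagTimeWeight β M ^ 2 * Bf * max 1 (Atot / imagTimeWeight β M) ≤ CEf₀) ∧
    -- (e) the domination of the read-out with `Cinc₁ Dinc₁` (base group) by `aT₁·(β/M)/Bf²`, `qT₁·(M/β)²`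
    (∀ (Aro Qro Qtot Atot : ℝ), Aro = Cinc₁ * Ab₀ → Qro = Dinc₁ * Qb₀ → Qtot = Dinc₁ * max 1 (max Qro (max (4 * Q'₀) (2 * τ₀ * ψ₀ * Q'₀))) →
      Atot = Aro + Cinc₁ * (A'₀ * (4 * σ₀ * lam * Q'₀ / (1 - 4 * σ₀ * lam * Q'₀)) +
        exp 1 * (τ₀ * (ι₁₀ * lam + ι₂₀ / (2 * Q'₀) + ι₃₀ / (4 * Q'₀ ^ 2) + A'₀ * Q'₀ / 4)) *
          (Φ₀ * (τ₀ * (ι₁₀ * lam + ι₂₀ / (2 * Q'₀) + ι₃₀ / (4 * Q'₀ ^ 2) + A'₀ * Q'₀ / 4)) /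
            (1 - Φ₀ * (τ₀ * (ι₁₀ * lam + ι₂₀ / (2 * Q'₀) + ι₃₀ / (4 * Q'₀ ^ 2) + A'₀ * Q'₀ / 4)))) / (2 * τ₀ * Q'₀)) →
      Atot ≤ aT₁ * (β / M) / Bf ^ 2 ∧ Qtot ≤ qT₁ * ((M : ℝ) / β) ^ 2) := by
  -- §0 constants
  have he0 : (0 : ℝ) < klE0 := by norm_num [klE0]
  have hKlam0 : 0 < Klam := lt_of_lt_of_le one_pos hKlam
  have hκ0 : 0 < κ := lt_of_lt_of_le one_pos hκ
  have hab₀0 : 0 < ab₀ := by rw [hab₀]; positivity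
  have hqb₀0 : 0 < qb₀ := by rw [hqb₀]; positivity
  have hW₀₀0 : 0 < W₀₀ := by rw [hW₀₀]; norm_num
  have hZ₀₀0 : 0 < Z₀₀ := by rw [hZ₀₀]; positivity
  have hi₂₀0 : 0 ≤ i₂₀ := by rw [hi₂₀]; positivity
  have hBf0 : 0 < Bf := lt_of_lt_of_le one_pos hBf1
  have hug0 : 0 < ug := by rw [hug]; positivity
  obtain ⟨huf₀0, haT₁0, hqT₁0, hCEf₀0, hZ⟩ := levNumerics_packageZWN hCinc₀ hDinc₀ hCinc₁ hDinc₁ hCκ₀ hCα hCJ₀ hab₀0 hqb₀0 hi₂₀0 hW₀₀ hZ₀₀ hs₀₀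
    ht₀₀ hp₀₀ hφ₀₀ hQL₀ hQH₀ haP₀ hsC₀ hΘ₀ huf₀ haT₀ haT₁ hqT₀ hqT₁ hCEf₀ hBf1 hBf₀
  refine ⟨huf₀0, haT₁0, hqT₁0, hCEf₀0, hug0, ?_⟩
  intro β M _ hβ hβM U c hU hU1 hc hUug hcug Ab₀ Qb₀ hAb₀ hQb₀ αb₀ κb₀ crb₀ ccb₀ W₀ Z₀ σ₀ τ₀ ψ₀ Φ₀ hαb₀ hκb₀ hcrb₀ hccb₀ hW₀ hZ₀ hσ₀ hτ₀ hψ₀ hΦ₀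
    lam₀ lam hlam₀ hlam₀1 hlamκ hlamuf A'₀ Q'₀ ι₁₀ ι₂₀ ι₃₀ hA'₀ hQ'₀ hι₁₀ hι₂₀ hι₃₀
  have hM0 : (0 : ℝ) < M := Nat.cast_pos.2 (Nat.pos_of_ne_zero (NeZero.ne M))
  have hβ0 : β ≠ 0 := hβ.ne'
  have hMne : (M : ℝ) ≠ 0 := hM0.ne'
  set r : ℝ := β / M with hr
  have hr0 : 0 < r := by positivity
  have hMβ : (M : ℝ) / β = 1 / r := by rw [hr]; field_simp
  have hitw : imagTimeWeight β M = r / 2 := by rw [imagTimeWeight, hr]; field_simp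
  have habsU : |U| = U := abs_of_pos hU
  -- the pins `W₀ = W₀₀`, `Z₀ = Z₀₀`
  have hW₀' : W₀ = W₀₀ := by rw [hW₀₀]; exact levPinW_W hCJ₀.ne' hβ0 hMne hcrb₀ hccb₀ hW₀
  have hZ₀' : Z₀ = Z₀₀ := by rw [hZ₀₀]; exact levPinW_Z hβ0 hMne hccb₀ hZ₀
  have hW₀0 : 0 < W₀ := by rw [hW₀']; exact hW₀₀0
  have hZ₀0 : 0 < Z₀ := by rw [hZ₀']; exact hZ₀₀0
  -- couplings
  have hlam₀0 : 0 < lam₀ := lt_of_lt_of_le (by positivity) hlam₀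
  have hlam0 : 0 < lam := lt_of_lt_of_le hlam₀0 hlam₀1
  -- the datum shapes in ZWN's currency
  have hAb₀' : Ab₀ = ab₀ * (β / M) / Bf ^ 2 := by rw [hAb₀, hitw, hab₀, hr]; field_simp
  have hQb₀' : Qb₀ = qb₀ * ((M : ℝ) / β) ^ 2 := by rw [hQb₀, hitw, hqb₀, hMβ]; field_simp; ring
  have hAb₀0 : 0 ≤ Ab₀ := by rw [hAb₀']; positivity
  have hQb₀0 : 0 ≤ Qb₀ := by rw [hQb₀']; positivity
  -- the slots: signs and the four-leg slot on its shape
  have htwo0 : 0 ≤ W₀ * Z₀ ^ 1 * (T₁ * (|U| + c) / imagTimeWeight β M) := by rw [habsU, hitw]; positivity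
  have hfour0 : 0 ≤ W₀ * Z₀ ^ 2 * (A₁ * P₁ ^ 2 * |U| / imagTimeWeight β M ^ 3) := by rw [habsU, hitw]; positivity
  have hι₁₀0 : 0 ≤ ι₁₀ := by rw [hι₁₀]; positivity
  have hι₂₀0 : 0 ≤ ι₂₀ := by rw [hι₂₀]; positivity
  have hι₂₀le : ι₂₀ ≤ i₂₀ * ((M : ℝ) / β) ^ 3 / Bf := by
    -- `ι₂₀ = 8W₀₀Z₀₀²A₁P₁²·U/(r³λ₀) ≤ 8W₀₀Z₀₀²A₁P₁²/(r³·Bf·Klam)` from `Bf·Klam·U ≤ λ₀`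
    have h1 : U / lam₀ ≤ 1 / (Bf * Klam) := by
      rw [div_le_div_iff₀ hlam₀0 (by positivity), one_mul]; linarith
    have heq : ι₂₀ = 8 * W₀₀ * Z₀₀ ^ 2 * A₁ * P₁ ^ 2 / r ^ 3 * (U / lam₀) := by
      rw [hι₂₀, hW₀', hZ₀', habsU, hitw]; field_simp; ring
    have heq' : i₂₀ * ((M : ℝ) / β) ^ 3 / Bf = 8 * W₀₀ * Z₀₀ ^ 2 * A₁ * P₁ ^ 2 / r ^ 3 * (1 / (Bf * Klam)) := by
      rw [hi₂₀, hMβ]; field_simp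
    rw [heq, heq']; exact mul_le_mul_of_nonneg_left h1 (by positivity)
  -- the two-leg product: `ι₁₀·λ ≤ κ·ι₁₀·λ₀ = κ·2W₀₀Z₀₀T₁(U + c)/r ≤ (1/r)/Bf` by the door `U, c ≤ ug`
  have hprod₀ : ι₁₀ * lam₀ = 2 * W₀₀ * Z₀₀ * T₁ * (U + c) / r := by
    rw [hι₁₀, hW₀', hZ₀', habsU, hitw]; field_simp
  have hprod : ι₁₀ * lam ≤ ((M : ℝ) / β) / Bf := by
    have h1 : ι₁₀ * lam ≤ κ * (ι₁₀ * lam₀) := by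
      calc ι₁₀ * lam ≤ ι₁₀ * (κ * lam₀) := mul_le_mul_of_nonneg_left hlamκ hι₁₀0
        _ = κ * (ι₁₀ * lam₀) := by ring
    have hUc : U + c ≤ 2 * ug := by linarith
    have h2 : κ * (2 * W₀₀ * Z₀₀ * T₁ * (U + c)) * Bf ≤ 1 := by
      have h3 : κ * (2 * W₀₀ * Z₀₀ * T₁ * (U + c)) * Bf ≤ κ * (2 * W₀₀ * Z₀₀ * T₁ * (2 * ug)) * Bf := by gcongr
      have h4 : κ * (2 * W₀₀ * Z₀₀ * T₁ * (2 * ug)) * Bf = 4 * W₀₀ * Z₀₀ * T₁ * κ * Bf / (4 * W₀₀ * Z₀₀ * T₁ * κ * Bf + 1) := by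
        rw [hug]; field_simp; norm_num
      have h5 : 4 * W₀₀ * Z₀₀ * T₁ * κ * Bf / (4 * W₀₀ * Z₀₀ * T₁ * κ * Bf + 1) ≤ 1 := by
        rw [div_le_one (by positivity)]; linarith
      linarith
    rw [hMβ]
    calc ι₁₀ * lam ≤ κ * (ι₁₀ * lam₀) := h1
      _ = κ * (2 * W₀₀ * Z₀₀ * T₁ * (U + c)) * Bf / (r * Bf) := by rw [hprod₀]; field_simp
      _ ≤ 1 / (r * Bf) := div_le_div_of_nonneg_right h2 (by positivity)
      _ = 1 / r / Bf := by rw [div_div]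
  -- ZWN at this group
  have hZ' := hZ β M hβ hβM Ab₀ Qb₀ ι₂₀ hAb₀' hQb₀' hι₂₀0 hι₂₀le αb₀ κb₀ crb₀ ccb₀ W₀ Z₀ σ₀ τ₀ ψ₀ Φ₀ hαb₀ hκb₀ hcrb₀ hccb₀ hW₀ hZ₀ hσ₀ hτ₀ hψ₀ hΦ₀
    A'₀ Q'₀ ι₃₀ hA'₀ hQ'₀ hι₃₀
  obtain ⟨⟨_, _, hA'₀0, hQ'₀0, hZQ, hι₃₀0, hZQ3, hΦ₀0, hτ₀0, _, _⟩, hrows, hCE, hdom, hguard⟩ := hZ'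
  have hrows' := hrows lam ι₁₀ hlam0.le hlamuf hι₁₀0 hprod
  -- (a)
  have hdomι₃ : W₀ * Z₀ ^ 3 * Ab₀ * Qb₀ ^ 3 ≤ ι₃₀ := by
    rw [hι₃₀, hA'₀]
    calc W₀ * Z₀ ^ 3 * Ab₀ * Qb₀ ^ 3 = W₀ * Ab₀ * (Z₀ ^ 3 * Qb₀ ^ 3) := by ring
      _ ≤ W₀ * Ab₀ * Q'₀ ^ 3 := mul_le_mul_of_nonneg_left hZQ3 (by positivity)
  have htwo : W₀ * Z₀ ^ 1 * (T₁ * (|U| + c) / imagTimeWeight β M) ≤ ι₁₀ * lam := by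
    have heq : W₀ * Z₀ ^ 1 * (T₁ * (|U| + c) / imagTimeWeight β M) = ι₁₀ * lam₀ := by rw [hι₁₀]; field_simp
    rw [heq]; exact mul_le_mul_of_nonneg_left hlam₀1 hι₁₀0
  have hfour : W₀ * Z₀ ^ 2 * (A₁ * P₁ ^ 2 * |U| / imagTimeWeight β M ^ 3) ≤ ι₂₀ * lam := by
    have heq : W₀ * Z₀ ^ 2 * (A₁ * P₁ ^ 2 * |U| / imagTimeWeight β M ^ 3) = ι₂₀ * lam₀ := by rw [hι₂₀]; field_simp
    rw [heq]; exact mul_le_mul_of_nonneg_left hlam₀1 hι₂₀0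
  refine ⟨⟨hA'₀0, hQ'₀0, le_of_eq hA'₀.symm, hZQ, hdomι₃⟩, ⟨htwo, hfour, hrows'⟩, ?_, ?_, ?_⟩
  -- (c) the majorant array and its guard
  · intro ν hν
    have hν1 : ν 1 = W₀ * Z₀ ^ 1 * (T₁ * (|U| + c) / imagTimeWeight β M) := by rw [hν]; simp
    have hν2 : ν 2 = W₀ * Z₀ ^ 2 * (A₁ * P₁ ^ 2 * |U| / imagTimeWeight β M ^ 3) := by rw [hν]; simp
    have hνm : ∀ m, 3 ≤ m → ν m = W₀ * Z₀ ^ m * (Ab₀ * lam ^ (m - 1) * Qb₀ ^ m) := by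
      intro m hm; rw [hν]; simp only; rw [if_neg (by omega), if_neg (by omega)]
    refine ⟨fun m hm => le_of_eq (hνm m hm).symm, le_of_eq hν1.symm, le_of_eq hν2.symm, fun D => ?_⟩
    have hν0 : ∀ m, 0 ≤ ν m := by
      intro m
      rcases Nat.lt_or_ge m 3 with h | h
      · interval_cases m
        · rw [hν]; simp only; rw [if_neg (by omega), if_neg (by omega)]; positivity
        · rw [hν1]; exact htwo0
        · rw [hν2]; exact hfour0
      · rw [hνm m h]; positivity
    refine hguard lam ι₁₀ hlam0.le hlamuf hι₁₀0 hprod D ν hν0 (by rw [hν1]; exact htwo) (by rw [hν2]; exact hfour) ?_ ?_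
    · rw [hνm 3 le_rfl]
      calc W₀ * Z₀ ^ 3 * (Ab₀ * lam ^ (3 - 1) * Qb₀ ^ 3) = W₀ * Z₀ ^ 3 * Ab₀ * Qb₀ ^ 3 * lam ^ 2 := by ring
        _ ≤ ι₃₀ * lam ^ 2 := mul_le_mul_of_nonneg_right hdomι₃ (by positivity)
    · intro m hm4 _
      rw [hνm m (by omega), hA'₀]
      have hZQm : (Z₀ * Qb₀) ^ m ≤ Q'₀ ^ m := pow_le_pow_left₀ (by positivity) hZQ m
      calc W₀ * Z₀ ^ m * (Ab₀ * lam ^ (m - 1) * Qb₀ ^ m) = W₀ * Ab₀ * lam ^ (m - 1) * (Z₀ * Qb₀) ^ m := by rw [mul_pow]; ring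
        _ ≤ W₀ * Ab₀ * lam ^ (m - 1) * Q'₀ ^ m := mul_le_mul_of_nonneg_left hZQm (by positivity)
  -- (d) the CE row
  · intro Aro Qro Qtot Atot hAro hQro hQtot hAtot
    exact hCE lam ι₁₀ hlam0.le hlamuf hι₁₀0 hprod Aro Qro Qtot Atot hAro hQro hQtot hAtot
  -- (e) the domination
  · intro Aro Qro Qtot Atot hAro hQro hQtot hAtot
    exact hdom lam ι₁₀ hlam0.le hlamuf hι₁₀0 hprod Aro Qro Qtot Atot hAro hQro hQtot hAtot

end Summit.HubbardSuperconductivity.HubbardSuperconductivity.Theorems.EngineV8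

end
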